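import Summits.KontsevichZagierPeriods.KontsevichZagierPeriods.Theorems.PlanarCompiler.Negative.GreenTightness

/-!
# `PlanarCompiler` (stmt-KontsevichZagierPeriods-10058) — negative side VII: a twist-positive sign cell can fold horizontally

Refuter `cdisprove` (gen 2, cycle 2), for the PICKED line `twist-restoring-shear` as reshaped by the
lead (`λ = 0`; `stub_signedSweep` = "vertical sign-CAD of the open triangle …, injectivity of BOTH
sheared projections"; `stub_shearedTransport` needs both, `Negative/EngineInjectivity.lean`).
THE TRAP: a cell of the vertical sign-CAD — an open band `{a ∈ (u,v), g a < b < h a}` inside the open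
triangle on which the twist `∂_bA = ∂_aB` is POSITIVE, bounded below by the zero curve of the twist
and above by the hypotenuse — makes the vertical sweep `Ψ₁ = (a, A)` injective for free (strict
monotonicity on interval fibres), but NOT the horizontal sweep `Ψ₂ = (b, B)`: its horizontal slices
`{a ∈ (u,v) : g a < b}` are disconnected where the zero curve humps above `b`, and `a ↦ B(a,b)`
decreases in the gap. Polynomial datum (everything rational):
`S = a³b − (3/2)a²b + ab²/2 + ab/2`, `A = ∂_aS = b²/2 − b·β(a)`, `B = ∂_bS = a³ − (3/2)a² + ab + a/2`,
twist `τ = b − β(a)` with `β(a) = −3a² + 3a − 1/2`; the positive cell over the middle interval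
`(½ − √3/6, ½ + √3/6)` (where `β > 0`) is `{β(a) < b < 1 − a}`, and on its slice `b = 3/16` the
points `a = 1/4`, `a = 3/4` (and `a = 1/2`) have the same `B = 3/32`:
`not_posTwistBandSweepInjective`. So `stub_signedSweep` must refine the sign cells a second time
(a CAD in the direction `b` of each cell; `Ψ₁`-injectivity is inherited by sub-cells), exactly as
the registered `stub_genericShear` leaves room for; a proof attempt that returns the sign cells
themselves is doomed. [Kontsevich–Zagier 2001, §1.2; Arnold 1989, §48; Bochnak–Coste–Roy 1998, §2.3]
-/

noncomputable section

open MeasureTheory Set MvPolynomial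
open Literature.NumberTheory.Transcendental Literature.ModelTheory.ExponentialFields

namespace Summit.KontsevichZagierPeriods.SymplecticScissors.PlanarCompilerNegative

/-! ## §7.0 The polynomial Green datum with a humped zero-twist curve -/

/-- The zero curve of the twist: `β(a) = −3a² + 3a − 1/2` (a hump, positive on `(½ − √3/6, ½ + √3/6)`). [folklore] -/
def hump (a : ℝ) : ℝ := -3 * a ^ 2 + 3 * a - 1 / 2

/-- The potential `S = a³b − (3/2)a²b + ab²/2 + ab/2`. [folklore] -/
def cellS : (Fin 2 → ℝ) → ℝ := fun q =>
  q 0 ^ 3 * q 1 - 3 / 2 * (q 0 ^ 2 * q 1) + q 0 * q 1 ^ 2 * (1 / 2) + q 0 * q 1 * (1 / 2)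

/-- `A = ∂_aS = 3a²b − 3ab + b²/2 + b/2 = b²/2 − b·β(a)`. [folklore] -/
def cellA : (Fin 2 → ℝ) → ℝ := fun q => 3 * (q 0 ^ 2 * q 1) - 3 * (q 0 * q 1) + q 1 ^ 2 * (1 / 2) + q 1 * (1 / 2)

/-- `B = ∂_bS = a³ − (3/2)a² + ab + a/2`. [folklore] -/
def cellB : (Fin 2 → ℝ) → ℝ := fun q => q 0 ^ 3 - 3 / 2 * q 0 ^ 2 + q 0 * q 1 + q 0 * (1 / 2)

/-- The twist `τ = ∂_bA = ∂_aB = 3a² − 3a + b + 1/2 = b − β(a)`. [folklore] -/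
def twist : (Fin 2 → ℝ) → ℝ := fun q => 3 * q 0 ^ 2 - 3 * q 0 + q 1 + 1 / 2

/-- `τ = b − β(a)`. [folklore] -/
theorem twist_eq (q : Fin 2 → ℝ) : twist q = q 1 - hump (q 0) := by
  simp only [twist, hump]; ring

/-- `dS = A da + B db` everywhere. [folklore] -/
theorem hasFDerivAt_cellS (p : Fin 2 → ℝ) :
    HasFDerivAt cellS (cellA p • ContinuousLinearMap.proj (R := ℝ) (φ := fun _ : Fin 2 => ℝ) 0 +
      cellB p • ContinuousLinearMap.proj (R := ℝ) (φ := fun _ : Fin 2 => ℝ) 1) p := by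
  have h0 : HasFDerivAt (fun q : Fin 2 → ℝ => q 0) (ContinuousLinearMap.proj (R := ℝ)
      (φ := fun _ : Fin 2 => ℝ) 0) p := hasFDerivAt_apply 0 p
  have h1 : HasFDerivAt (fun q : Fin 2 → ℝ => q 1) (ContinuousLinearMap.proj (R := ℝ)
      (φ := fun _ : Fin 2 => ℝ) 1) p := hasFDerivAt_apply 1 p
  have h := ((((h0.pow 3).mul h1).sub (((h0.pow 2).mul h1).const_mul (3 / 2))).add
    ((h0.mul (h1.pow 2)).mul_const (1 / 2))).add ((h0.mul h1).mul_const (1 / 2))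
  refine h.congr_fderiv ?_
  ext v
  simp [cellA, cellB]
  ring

/-- Derivative of `A`. [folklore] -/
theorem hasFDerivAt_cellA (p : Fin 2 → ℝ) :
    HasFDerivAt cellA ((6 * p 0 * p 1 - 3 * p 1) • ContinuousLinearMap.proj (R := ℝ) (φ := fun _ : Fin 2 => ℝ) 0 +
      twist p • ContinuousLinearMap.proj (R := ℝ) (φ := fun _ : Fin 2 => ℝ) 1) p := by
  have h0 : HasFDerivAt (fun q : Fin 2 → ℝ => q 0) (ContinuousLinearMap.proj (R := ℝ)
      (φ := fun _ : Fin 2 => ℝ) 0) p := hasFDerivAt_apply 0 p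
  have h1 : HasFDerivAt (fun q : Fin 2 → ℝ => q 1) (ContinuousLinearMap.proj (R := ℝ)
      (φ := fun _ : Fin 2 => ℝ) 1) p := hasFDerivAt_apply 1 p
  have h := ((((h0.pow 2).mul h1).const_mul 3).sub ((h0.mul h1).const_mul 3)).add
    ((h1.pow 2).mul_const (1 / 2)) |>.add (h1.mul_const (1 / 2))
  refine h.congr_fderiv ?_
  ext v
  simp [twist]
  ring

/-- Derivative of `B`. [folklore] -/
theorem hasFDerivAt_cellB (p : Fin 2 → ℝ) :
    HasFDerivAt cellB (twist p • ContinuousLinearMap.proj (R := ℝ) (φ := fun _ : Fin 2 => ℝ) 0 +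
      p 0 • ContinuousLinearMap.proj (R := ℝ) (φ := fun _ : Fin 2 => ℝ) 1) p := by
  have h0 : HasFDerivAt (fun q : Fin 2 → ℝ => q 0) (ContinuousLinearMap.proj (R := ℝ)
      (φ := fun _ : Fin 2 => ℝ) 0) p := hasFDerivAt_apply 0 p
  have h1 : HasFDerivAt (fun q : Fin 2 → ℝ => q 1) (ContinuousLinearMap.proj (R := ℝ)
      (φ := fun _ : Fin 2 => ℝ) 1) p := hasFDerivAt_apply 1 p
  have h := (((h0.pow 3).sub ((h0.pow 2).const_mul (3 / 2))).add (h0.mul h1)).add (h0.mul_const (1 / 2))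
  refine h.congr_fderiv ?_
  ext v
  simp [twist]
  ring

/-- `∂_bA = τ`. [folklore] -/
theorem fderiv_cellA_e1 (p : Fin 2 → ℝ) : fderiv ℝ cellA p (Pi.single 1 1) = twist p := by
  rw [(hasFDerivAt_cellA p).fderiv]; simp

/-- `∂_aB = τ`. [folklore] -/
theorem fderiv_cellB_e0 (p : Fin 2 → ℝ) : fderiv ℝ cellB p (Pi.single 0 1) = twist p := by
  rw [(hasFDerivAt_cellB p).fderiv]; simp

/-- `A` is `C¹`. [folklore] -/
theorem contDiff_cellA : ContDiff ℝ 1 cellA := by unfold cellA; fun_prop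
/-- `B` is `C¹`. [folklore] -/
theorem contDiff_cellB : ContDiff ℝ 1 cellB := by unfold cellB; fun_prop
/-- `A` is continuous. [folklore] -/
theorem continuous_cellA : Continuous cellA := by unfold cellA; fun_prop
/-- `B` is continuous. [folklore] -/
theorem continuous_cellB : Continuous cellB := by unfold cellB; fun_prop

/-- `A` is a ℚ-semialgebraic function on the closed triangle (a polynomial over ℚ). [folklore] -/
theorem isSemialgebraicFunOn_cellA : IsSemialgebraicFunOn ℚ triangle cellA := by
  refine (isSemialgebraicFunOn_aeval isSemialgebraic_triangle
    (C 3 * (X 0 ^ 2 * X 1) - C 3 * (X 0 * X 1) + X 1 ^ 2 * C (1 / 2) + X 1 * C (1 / 2))).congr ?_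
  intro p _
  simp [cellA]

/-- `B` is a ℚ-semialgebraic function on the closed triangle (a polynomial over ℚ). [folklore] -/
theorem isSemialgebraicFunOn_cellB : IsSemialgebraicFunOn ℚ triangle cellB := by
  refine (isSemialgebraicFunOn_aeval isSemialgebraic_triangle
    (X 0 ^ 3 - C (3 / 2) * X 0 ^ 2 + X 0 * X 1 + X 0 * C (1 / 2))).congr ?_
  intro p _
  simp [cellB]

/-! ## §7.1 The positive sign cell over the middle interval -/

/-- `½ − √3/6`, the left root of `β`. [folklore] -/
def aMinus : ℝ := 1 / 2 - Real.sqrt 3 / 6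
/-- `½ + √3/6`, the right root of `β`. [folklore] -/
def aPlus : ℝ := 1 / 2 + Real.sqrt 3 / 6

/-- `(√3)² = 3`. [folklore] -/
theorem sq_sqrt_three : Real.sqrt 3 ^ 2 = 3 := Real.sq_sqrt (by norm_num)

/-- `3/2 < √3 < 3`. [folklore] -/
theorem sqrt_three_bounds : 3 / 2 < Real.sqrt 3 ∧ Real.sqrt 3 < 3 := by
  have h := sq_sqrt_three
  have h0 : 0 ≤ Real.sqrt 3 := Real.sqrt_nonneg 3
  constructor <;> nlinarith [h, h0]

/-- `β(a) = 3 (a − a₋)(a₊ − a)`. [folklore] -/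
theorem hump_eq (a : ℝ) : hump a = 3 * (a - aMinus) * (aPlus - a) := by
  unfold hump aMinus aPlus
  linear_combination (-1 / 12 : ℝ) * sq_sqrt_three

/-- `β > 0` on the middle interval. [folklore] -/
theorem hump_pos {a : ℝ} (ha : a ∈ Ioo aMinus aPlus) : 0 < hump a := by
  rw [hump_eq]
  have h1 : 0 < a - aMinus := sub_pos.mpr ha.1
  have h2 : 0 < aPlus - a := sub_pos.mpr ha.2
  positivity

/-- The middle interval lies inside `(0,1)`, with `1/4` and `3/4` inside it. [folklore] -/
theorem aMinus_aPlus_bounds : 0 < aMinus ∧ aMinus < 1 / 4 ∧ 3 / 4 < aPlus ∧ aPlus < 1 := by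
  obtain ⟨h1, h2⟩ := sqrt_three_bounds
  unfold aMinus aPlus
  refine ⟨?_, ?_, ?_, ?_⟩ <;> linarith

/-- `β(a) < 1 − a` everywhere (`3a² − 4a + 3/2 > 0`). [folklore] -/
theorem hump_lt_one_sub (a : ℝ) : hump a < 1 - a := by
  unfold hump; nlinarith [sq_nonneg (a - 2 / 3)]

/-- THE SIGN CELL: the open band over the middle interval between the zero-twist curve `b = β(a)`
and the hypotenuse `b = 1 − a`; it is the cell of the vertical sign-CAD of the open triangle on which
the twist is positive, over that interval. [folklore] -/
def posCell : Set (Fin 2 → ℝ) := {p | p 0 ∈ Ioo aMinus aPlus ∧ hump (p 0) < p 1 ∧ p 1 < 1 - p 0}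

/-- The sign cell lies in the open triangle. [folklore] -/
theorem posCell_subset_openTriangle :
    posCell ⊆ {p : Fin 2 → ℝ | 0 < p 0 ∧ 0 < p 1 ∧ p 0 + p 1 < 1} := by
  rintro p ⟨h0, h1, h2⟩
  obtain ⟨hm, -, -, hp⟩ := aMinus_aPlus_bounds
  exact ⟨by linarith [h0.1], (hump_pos h0).trans h1, by linarith⟩

/-- The twist is positive on the sign cell. [folklore] -/
theorem twist_pos_of_mem_posCell {p : Fin 2 → ℝ} (hp : p ∈ posCell) : 0 < twist p := by
  rw [twist_eq]; linarith [hp.2.1]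

/-- The bottom of the cell is the zero curve of the twist. [folklore] -/
theorem twist_bottom (a : ℝ) : twist ![a, hump a] = 0 := by
  rw [twist_eq]; simp

/-- The vertical sweep `Ψ₁ = (a, A)` IS injective on the sign cell (`A(a,·) = (b − β)²/2 − β²/2` is
strictly increasing for `b > β(a)`). [folklore] -/
theorem injOn_sweepA_posCell : Set.InjOn (fun p : Fin 2 → ℝ => (![p 0, cellA p] : Fin 2 → ℝ)) posCell := by
  intro p hp q hq hpq
  have h0 := congr_fun hpq 0
  have h1 := congr_fun hpq 1
  simp only [Matrix.cons_val_zero, Matrix.cons_val_one] at h0 h1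
  have hb : hump (p 0) < p 1 := hp.2.1
  have hb' : hump (p 0) < q 1 := by rw [h0]; exact hq.2.1
  have hA : ∀ r : Fin 2 → ℝ, cellA r = r 1 ^ 2 / 2 - r 1 * hump (r 0) := by
    intro r; simp only [cellA, hump]; ring
  rw [hA, hA, ← h0] at h1
  have hprod : (p 1 - q 1) * (p 1 + q 1 - 2 * hump (p 0)) = 0 := by linear_combination 2 * h1
  rcases mul_eq_zero.mp hprod with h | h
  · ext i; fin_cases i
    · exact h0
    · simpa [sub_eq_zero] using h
  · exfalso; linarith

/-- The two collision points `(1/4, 3/16)` and `(3/4, 3/16)`. [folklore] -/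
def leftPt : Fin 2 → ℝ := ![1 / 4, 3 / 16]
/-- The two collision points `(1/4, 3/16)` and `(3/4, 3/16)`. [folklore] -/
def rightPt : Fin 2 → ℝ := ![3 / 4, 3 / 16]

/-- `(1/4, 3/16)` lies in the sign cell. [folklore] -/
theorem leftPt_mem : leftPt ∈ posCell := by
  obtain ⟨-, h2, h3, -⟩ := aMinus_aPlus_bounds
  refine ⟨⟨?_, ?_⟩, ?_, ?_⟩ <;> norm_num [leftPt, hump] <;> linarith

/-- `(3/4, 3/16)` lies in the sign cell. [folklore] -/
theorem rightPt_mem : rightPt ∈ posCell := by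
  obtain ⟨-, h2, h3, -⟩ := aMinus_aPlus_bounds
  refine ⟨⟨?_, ?_⟩, ?_, ?_⟩ <;> norm_num [rightPt, hump] <;> linarith

/-- … and they collide under the horizontal sweep `Ψ₂ = (b, B)`: `B = 3/32` at both. [folklore] -/
theorem sweepB_leftPt_eq_rightPt :
    (![leftPt 1, cellB leftPt] : Fin 2 → ℝ) = ![rightPt 1, cellB rightPt] := by
  ext i; fin_cases i <;> norm_num [leftPt, rightPt, cellB]

/-- The two collision points are distinct. [folklore] -/
theorem leftPt_ne_rightPt : leftPt ≠ rightPt := by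
  intro h
  have := congr_fun h 0
  norm_num [leftPt, rightPt] at this

/-- THE TRAP: the horizontal sweep `Ψ₂ = (b, B)` is NOT injective on the sign cell. [folklore] -/
theorem not_injOn_sweepB_posCell :
    ¬ Set.InjOn (fun p : Fin 2 → ℝ => (![p 1, cellB p] : Fin 2 → ℝ)) posCell :=
  fun h => leftPt_ne_rightPt (h leftPt_mem rightPt_mem sweepB_leftPt_eq_rightPt)

/-! ## §7.2 The refuted belief: "twist-positive sign cells need no further refinement" -/

/-- "For Green data as typed in the crux, with `A, B` of class `C¹` and `∂_bA = ∂_aB` on the open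
triangle, and for any open band cell `C = {a ∈ (u,v), g a < b < h a}` of the open triangle bounded
below by the zero curve of the twist (`∂_bA (a, g a) = 0`) and above by the hypotenuse (`h a = 1 − a`)
on which the twist `∂_bA` is positive and the vertical sweep `(a, A)` is injective, the horizontal
sweep `(b, B)` is injective on `C`." — i.e. the cells of the vertical sign-CAD could be fed to the
engine as they are. -/
def PosTwistBandSweepInjective : Prop :=
  ∀ (A B S : (Fin 2 → ℝ) → ℝ) (u v : ℝ) (g h : ℝ → ℝ),
    IsSemialgebraicFunOn ℚ {p : Fin 2 → ℝ | 0 ≤ p 0 ∧ 0 ≤ p 1 ∧ p 0 + p 1 ≤ 1} A →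
    IsSemialgebraicFunOn ℚ {p : Fin 2 → ℝ | 0 ≤ p 0 ∧ 0 ≤ p 1 ∧ p 0 + p 1 ≤ 1} B →
    ContinuousOn A {p : Fin 2 → ℝ | 0 ≤ p 0 ∧ 0 ≤ p 1 ∧ p 0 + p 1 ≤ 1} →
    ContinuousOn B {p : Fin 2 → ℝ | 0 ≤ p 0 ∧ 0 ≤ p 1 ∧ p 0 + p 1 ≤ 1} →
    (∀ p : Fin 2 → ℝ, 0 < p 0 → 0 < p 1 → p 0 + p 1 < 1 →
      HasFDerivAt S (A p • ContinuousLinearMap.proj (R := ℝ) (φ := fun _ : Fin 2 => ℝ) 0 +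
        B p • ContinuousLinearMap.proj (R := ℝ) (φ := fun _ : Fin 2 => ℝ) 1) p) →
    ContDiffOn ℝ 1 A {p : Fin 2 → ℝ | 0 < p 0 ∧ 0 < p 1 ∧ p 0 + p 1 < 1} →
    ContDiffOn ℝ 1 B {p : Fin 2 → ℝ | 0 < p 0 ∧ 0 < p 1 ∧ p 0 + p 1 < 1} →
    (∀ p : Fin 2 → ℝ, 0 < p 0 → 0 < p 1 → p 0 + p 1 < 1 →
      fderiv ℝ A p (Pi.single 1 1) = fderiv ℝ B p (Pi.single 0 1)) →
    u < v → ContinuousOn g (Icc u v) → ContinuousOn h (Icc u v) → (∀ a ∈ Ioo u v, g a < h a) →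
    {p : Fin 2 → ℝ | p 0 ∈ Ioo u v ∧ g (p 0) < p 1 ∧ p 1 < h (p 0)} ⊆
      {p : Fin 2 → ℝ | 0 < p 0 ∧ 0 < p 1 ∧ p 0 + p 1 < 1} →
    (∀ a ∈ Ioo u v, fderiv ℝ A ![a, g a] (Pi.single 1 1) = 0) → (∀ a ∈ Ioo u v, h a = 1 - a) →
    (∀ p : Fin 2 → ℝ, p 0 ∈ Ioo u v → g (p 0) < p 1 → p 1 < h (p 0) → 0 < fderiv ℝ A p (Pi.single 1 1)) →
    Set.InjOn (fun p : Fin 2 → ℝ => (![p 0, A p] : Fin 2 → ℝ))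
      {p : Fin 2 → ℝ | p 0 ∈ Ioo u v ∧ g (p 0) < p 1 ∧ p 1 < h (p 0)} →
    Set.InjOn (fun p : Fin 2 → ℝ => (![p 1, B p] : Fin 2 → ℝ))
      {p : Fin 2 → ℝ | p 0 ∈ Ioo u v ∧ g (p 0) < p 1 ∧ p 1 < h (p 0)}

/-- THE SIGN CELL FOLDS HORIZONTALLY: `PosTwistBandSweepInjective` is FALSE (polynomial datum
`S = a³b − (3/2)a²b + ab²/2 + ab/2`, the sign cell `posCell`, collision `B(1/4, 3/16) = B(3/4, 3/16)`).
Hence the sign-CAD stub of the line must refine its cells in the direction `b` as well before the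
engine applies. [folklore] -/
theorem not_posTwistBandSweepInjective : ¬ PosTwistBandSweepInjective := by
  intro H
  have hcell : {p : Fin 2 → ℝ | p 0 ∈ Ioo aMinus aPlus ∧ hump (p 0) < p 1 ∧ p 1 < (fun a : ℝ => 1 - a) (p 0)}
      = posCell := rfl
  have h := H cellA cellB cellS aMinus aPlus hump (fun a => 1 - a)
    isSemialgebraicFunOn_cellA isSemialgebraicFunOn_cellB continuous_cellA.continuousOn
    continuous_cellB.continuousOn (fun p _ _ _ => hasFDerivAt_cellS p) contDiff_cellA.contDiffOn
    contDiff_cellB.contDiffOn (fun p _ _ _ => by rw [fderiv_cellA_e1, fderiv_cellB_e0])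
    (by obtain ⟨_, h2, h3, _⟩ := aMinus_aPlus_bounds; linarith)
    (by unfold hump; fun_prop) (by fun_prop) (fun a _ => hump_lt_one_sub a)
    (by rw [hcell]; exact posCell_subset_openTriangle)
    (fun a _ => by rw [fderiv_cellA_e1]; exact twist_bottom a) (fun a _ => rfl)
    (fun p h0 h1 h2 => by rw [fderiv_cellA_e1]; exact twist_pos_of_mem_posCell ⟨h0, h1, h2⟩)
    (by rw [hcell]; exact injOn_sweepA_posCell)
  rw [hcell] at h
  exact not_injOn_sweepB_posCell h

end Summit.KontsevichZagierPeriods.SymplecticScissors.PlanarCompilerNegative
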